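import Mathlib
import Summits.NavierStokesRegularity.NavierStokesRegularity.Theorems.FilamentSkeletonRssStadiumCauchyNumerator
import Summits.NavierStokesRegularity.NavierStokesRegularity.Theorems.FilamentSkeletonRssStadiumNearKernelBound

/-!
# The plateau: Lipschitz tangent along a horizontal line and the near-diagonal kernel bound (`TangentSkeletonNearStraightL`,
# stmt-NavierStokesRegularity-23320, registered stub `stub_stripPropagation` — ingredient `K₂` of the `√Γ log Γ` bound on the retyped contour)

On the plateau `{σ + iy₀}` of the own-filament contour every point carries a Cauchy disc of radius `R₀` inside the stadium (`R₀ = 7h` in the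
`cs√Γ/16` retype, see evidence `DIAG-addendum-contour-g2.md` on 23320), so `‖F″‖ ≤ M/R₀` there (Theorems.StadiumCauchyNumerator) and, by the mean
value inequality along the (convex) plateau, `‖F′(σ+iy₀) − F′(σ′+iy₀)‖ ≤ (M/R₀)|σ − σ′|` (`plateau_deriv_lipschitz`).  Feeding
Theorems.StadiumCauchyNumerator.norm_cross_chord_le gives the numerator bound `‖F′(ζ) ⨯₃ (F(z) − F(ζ))‖ ≤ 2M(M/R₀)(σ−τ)²` for `z = τ+iy₀`, `ζ = σ+iy₀`
(`plateau_numerator_le`), and with a principal-branch lower bound `Re Q ≥ c(σ−τ)²` (Theorems.StadiumContourPositivity(Abs), horizontal pairs) and the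
core `Re G ≥ A/2 ≥ Λ⁻¹/2` Theorems.StadiumNearKernelBound.near_kernel_norm_le yields the integrable near-diagonal majorant
`(c(σ−τ)² + κ/(2Λ))^{−3/2}·2M(M/R₀)(σ−τ)²` (`plateau_kernel_norm_le`) whose integral is the `log Γ` (Theorems.NearDiagonalLogIntegral).
HONEST FRAMING: a tool for a HYPOTHETICAL filament skeleton on the NEGATIVE side of a MODEL route; nothing here bears on Navier–Stokes regularity or
blow-up.  `--supports stmt-NavierStokesRegularity-23320`.
-/

set_option linter.dupNamespace false

noncomputable section

namespace Summit.NavierStokesRegularity.NavierStokesRegularity.Theorems.StadiumPlateauKernel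

open Set Metric
open scoped Matrix
open Summit.NavierStokesRegularity.NavierStokesRegularity.Theorems.StadiumCauchyNumerator
open Summit.NavierStokesRegularity.NavierStokesRegularity.Theorems.StadiumNearKernelBound

/-- **Lipschitz tangent along the plateau.**  `F` holomorphic on an open `U` with `‖F′‖ ≤ M`; every point `σ + iy₀`, `σ ∈ uIcc σ₁ σ₂`, carries a
closed disc of radius `R₀ > 0` inside `U`.  Then `‖F′(σ+iy₀) − F′(σ′+iy₀)‖ ≤ (M/R₀)|σ − σ′|` on the plateau. [folklore] -/
theorem plateau_deriv_lipschitz {U : Set ℂ} (hU : IsOpen U) {F : ℂ → (Fin 3 → ℂ)} (hF : DifferentiableOn ℂ F U)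
    {M R₀ y₀ σ₁ σ₂ : ℝ} (hM : ∀ w ∈ U, ‖deriv F w‖ ≤ M) (hR₀ : 0 < R₀)
    (hdisc : ∀ σ ∈ Set.uIcc σ₁ σ₂, closedBall ((σ : ℂ) + (y₀ : ℂ) * Complex.I) R₀ ⊆ U)
    {σ σ' : ℝ} (hσ : σ ∈ Set.uIcc σ₁ σ₂) (hσ' : σ' ∈ Set.uIcc σ₁ σ₂) :
    ‖deriv F ((σ : ℂ) + (y₀ : ℂ) * Complex.I) - deriv F ((σ' : ℂ) + (y₀ : ℂ) * Complex.I)‖ ≤ M / R₀ * |σ - σ'| := by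
  -- the plateau as a convex set
  set Pl : Set ℂ := {w : ℂ | w.im = y₀ ∧ w.re ∈ Set.uIcc σ₁ σ₂} with hPl
  have hconv : Convex ℝ Pl := by
    have h1 : Convex ℝ {w : ℂ | w.im = y₀} := by
      have : {w : ℂ | w.im = y₀} = Complex.imLm ⁻¹' {y₀} := by ext w; simp
      rw [this]; exact (convex_singleton y₀).linear_preimage _
    have h2 : Convex ℝ {w : ℂ | w.re ∈ Set.uIcc σ₁ σ₂} := by
      have : {w : ℂ | w.re ∈ Set.uIcc σ₁ σ₂} = Complex.reLm ⁻¹' Set.uIcc σ₁ σ₂ := by ext w; simp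
      rw [this]; exact (convex_uIcc σ₁ σ₂).linear_preimage _
    have : Pl = {w : ℂ | w.im = y₀} ∩ {w : ℂ | w.re ∈ Set.uIcc σ₁ σ₂} := by ext w; simp [hPl]
    rw [this]; exact h1.inter h2
  have hmemPl : ∀ w ∈ Pl, w = ((w.re : ℝ) : ℂ) + (y₀ : ℂ) * Complex.I := by
    intro w hw
    have h := (Complex.re_add_im w).symm
    rw [hw.1] at h
    exact h
  have hsubU : ∀ w ∈ Pl, closedBall w R₀ ⊆ U := by
    intro w hw
    rw [hmemPl w hw]
    exact hdisc w.re hw.2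
  have hG : DifferentiableOn ℂ (deriv F) U := ((hF.analyticOnNhd hU).deriv).differentiableOn
  have hdiff : ∀ w ∈ Pl, DifferentiableAt ℂ (deriv F) w := fun w hw =>
    hG.differentiableAt (hU.mem_nhds (hsubU w hw (mem_closedBall_self hR₀.le)))
  have hbound : ∀ w ∈ Pl, ‖deriv (deriv F) w‖ ≤ M / R₀ := fun w hw =>
    norm_deriv_deriv_le_of_closedBall hU hF hM hR₀ (hsubU w hw)
  have hζ : ((σ : ℂ) + (y₀ : ℂ) * Complex.I) ∈ Pl := ⟨by simp, by simpa using hσ⟩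
  have hζ' : ((σ' : ℂ) + (y₀ : ℂ) * Complex.I) ∈ Pl := ⟨by simp, by simpa using hσ'⟩
  have h := Convex.norm_image_sub_le_of_norm_deriv_le hdiff hbound hconv hζ' hζ
  have hdist : ‖((σ : ℂ) + (y₀ : ℂ) * Complex.I) - ((σ' : ℂ) + (y₀ : ℂ) * Complex.I)‖ = |σ - σ'| := by
    have : ((σ : ℂ) + (y₀ : ℂ) * Complex.I) - ((σ' : ℂ) + (y₀ : ℂ) * Complex.I) = ((σ - σ' : ℝ) : ℂ) := by
      push_cast; ring
    rw [this, Complex.norm_real, Real.norm_eq_abs]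
  rw [hdist] at h
  exact h

/-- **Numerator bound on the plateau**: for `z = τ + iy₀`, `ζ = σ + iy₀` on the plateau, `‖F′(ζ) ⨯₃ (F(z) − F(ζ))‖ ≤ 2M(M/R₀)(σ − τ)²`. [folklore] -/
theorem plateau_numerator_le {U : Set ℂ} (hU : IsOpen U) {F : ℂ → (Fin 3 → ℂ)} (hF : DifferentiableOn ℂ F U)
    {M R₀ y₀ σ₁ σ₂ : ℝ} (hM : ∀ w ∈ U, ‖deriv F w‖ ≤ M) (hR₀ : 0 < R₀)
    (hdisc : ∀ σ ∈ Set.uIcc σ₁ σ₂, closedBall ((σ : ℂ) + (y₀ : ℂ) * Complex.I) R₀ ⊆ U)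
    {τ σ : ℝ} (hτ : τ ∈ Set.uIcc σ₁ σ₂) (hσ : σ ∈ Set.uIcc σ₁ σ₂) :
    ‖deriv F (((τ : ℂ) + (y₀ : ℂ) * Complex.I) + ((σ - τ : ℝ) : ℂ)) ⨯₃
        (F ((τ : ℂ) + (y₀ : ℂ) * Complex.I) - F (((τ : ℂ) + (y₀ : ℂ) * Complex.I) + ((σ - τ : ℝ) : ℂ)))‖ ≤
      2 * M * (M / R₀) * (σ - τ) ^ 2 := by
  set z : ℂ := (τ : ℂ) + (y₀ : ℂ) * Complex.I with hz
  have hM0 : 0 ≤ M := (norm_nonneg _).trans (hM _ (hdisc τ hτ (mem_closedBall_self hR₀.le)))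
  -- points `z + r`, `r ∈ uIcc 0 (σ − τ)`, are plateau points with parameter `τ + r ∈ uIcc σ₁ σ₂`
  have hpar : ∀ r ∈ Set.uIcc 0 (σ - τ), τ + r ∈ Set.uIcc σ₁ σ₂ := by
    intro r hr
    rcases Set.mem_uIcc.1 hτ with ⟨h1, h2⟩ | ⟨h1, h2⟩ <;> rcases Set.mem_uIcc.1 hσ with ⟨h3, h4⟩ | ⟨h3, h4⟩ <;>
      rcases Set.mem_uIcc.1 hr with ⟨h5, h6⟩ | ⟨h5, h6⟩ <;>
      first | exact Set.mem_uIcc.2 (Or.inl ⟨by linarith, by linarith⟩) | exact Set.mem_uIcc.2 (Or.inr ⟨by linarith, by linarith⟩)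
  have hpt : ∀ r : ℝ, z + (r : ℂ) = ((τ + r : ℝ) : ℂ) + (y₀ : ℂ) * Complex.I := by
    intro r; simp [hz]; ring
  have hseg : ∀ r ∈ Set.uIcc 0 (σ - τ), z + (r : ℂ) ∈ U := by
    intro r hr
    rw [hpt r]
    exact hdisc _ (hpar r hr) (mem_closedBall_self hR₀.le)
  have hB₁ : ‖deriv F (z + ((σ - τ : ℝ) : ℂ))‖ ≤ M := hM _ (hseg _ Set.right_mem_uIcc)
  have hK₂ : ∀ r ∈ Set.uIcc 0 (σ - τ), ‖deriv F (z + (r : ℂ)) - deriv F (z + ((σ - τ : ℝ) : ℂ))‖ ≤ M / R₀ * |r - (σ - τ)| := by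
    intro r hr
    rw [hpt r, hpt (σ - τ)]
    have h := plateau_deriv_lipschitz hU hF hM hR₀ hdisc (hpar r hr) (hpar _ Set.right_mem_uIcc)
    have e : |τ + r - (τ + (σ - τ))| = |r - (σ - τ)| := by congr 1; ring
    rw [e] at h
    exact h
  exact norm_cross_chord_le hU hF hseg hB₁ (by positivity) hK₂

/-- **Near-diagonal plateau majorant.**  With a principal-branch lower bound `Re Q ≥ c(σ−τ)²` (`c ≥ 0`) for the complexified chord between the
plateau points and the matched core `Re G ≥ A/2`, `Λ⁻¹ ≤ A`, `0 < κ`, `0 < Λ`: the kernel is bounded by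
`(c(σ−τ)² + κ/(2Λ))^{−3/2}·(2M(M/R₀)(σ−τ)²)`. [folklore] -/
theorem plateau_kernel_norm_le {U : Set ℂ} (hU : IsOpen U) {F : ℂ → (Fin 3 → ℂ)} (hF : DifferentiableOn ℂ F U)
    {M R₀ y₀ σ₁ σ₂ : ℝ} (hM : ∀ w ∈ U, ‖deriv F w‖ ≤ M) (hR₀ : 0 < R₀)
    (hdisc : ∀ σ ∈ Set.uIcc σ₁ σ₂, closedBall ((σ : ℂ) + (y₀ : ℂ) * Complex.I) R₀ ⊆ U)
    {τ σ : ℝ} (hτ : τ ∈ Set.uIcc σ₁ σ₂) (hσ : σ ∈ Set.uIcc σ₁ σ₂)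
    {c κ Λ A : ℝ} {Gv : ℂ} (hκ : 0 < κ) (hΛ : 0 < Λ) (hA : Λ⁻¹ ≤ A) (hc : 0 ≤ c) (hG : A / 2 ≤ Gv.re)
    (hQ : c * (σ - τ) ^ 2 ≤ (∑ i, (F (((τ : ℂ) + (y₀ : ℂ) * Complex.I) + ((σ - τ : ℝ) : ℂ)) i -
      F ((τ : ℂ) + (y₀ : ℂ) * Complex.I) i) ^ 2).re) :
    ‖(((∑ i, (F (((τ : ℂ) + (y₀ : ℂ) * Complex.I) + ((σ - τ : ℝ) : ℂ)) i - F ((τ : ℂ) + (y₀ : ℂ) * Complex.I) i) ^ 2)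
        + (κ : ℂ) * Gv) ^ ((3:ℂ) / 2))⁻¹ •
      (deriv F (((τ : ℂ) + (y₀ : ℂ) * Complex.I) + ((σ - τ : ℝ) : ℂ)) ⨯₃
        (F ((τ : ℂ) + (y₀ : ℂ) * Complex.I) - F (((τ : ℂ) + (y₀ : ℂ) * Complex.I) + ((σ - τ : ℝ) : ℂ))))‖ ≤
      (c * (σ - τ) ^ 2 + κ / (2 * Λ)) ^ (-(3/2 : ℝ)) * (2 * M * (M / R₀) * (σ - τ) ^ 2) := by
  have hnum := plateau_numerator_le hU hF hM hR₀ hdisc hτ hσ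
  exact near_kernel_norm_le hκ hΛ hA hc hQ hG hnum

end Summit.NavierStokesRegularity.NavierStokesRegularity.Theorems.StadiumPlateauKernel

end
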